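import Summits.QuantumFields.YangMills.Theorems.BalabanUVNodesN12DirectChartPackageOfClassRowL1
import Summits.QuantumFields.YangMills.Theorems.BalabanUVNodesN12DirectChartPackageOfClassL1Family

/-!
# DAG node N12 [B15] — THE PER-ROW ℓ¹ PREIMAGE LETTER's INHABITANTS AND THE FAMILY FORM OF THE ρ6b CHART HALF (sequel of `N12DirectChartPackageOfClassRowL1`, split for the
# 400-line lint; uniformity pen ρ6b, census §7 U2b at the consumer)

Cell `pub-ymgap`, HUMAN RULINGS D-0062 ∕ D-0149, lane owner `pub-ymgap-dag-n12-c` (g22).  Key K1⁹ `stmt-QuantumFields-27364`, `--kind proof --supports … --as helper`; count-neutral.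
NEW leaf; CONSUMED BY NAME: `N12DirectChartPackageOfClassRowL1.exists_hWD_chartHalf_of_class_uniform_rowl1` (§2 of the parent), `N12DirectChartPackageOfClassL1Family.sum_opNorm_le_natCard_mul_norm_of_support`
∕ `pi_norm_le_sum_norm` (ρ6 sequel), dag-n12-w4's `Node00.fderiv_msChart_apply_levelZero` (exact Γ₀ layer).

THIS FILE.
* §1 inhabitants of the per-row ℓ¹ preimage letter `hrow : ∀ i, 1 ≤ level i → ∀ ξ, ∃ x, DΨ(0) x = e_i ξ ∧ Σ_b ‖↑x_b‖_op ≤ B₁‖ξ‖`: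
  ★★ `hrow_of_hHB1` — from ANY right inverse `H` with ρ6's ℓ¹ → ℓ¹ letter (at the same `B₁`): `x := H (e_i ξ)`, whose output vanishes off `Ω₁(Z)` because `e_i ξ` is level-0-free for a
  positive-level `i` and the Γ₀ layer of `DΨ(0)` is exact — so today's inhabitants of `hHB1` (`…L1Family.hHB1_of_hHB ∘` p678596, `hHB1_of_hSup ∘` dag-n12-w6's sup letter) inhabit `hrow`;
  ★★ `hrow_of_hHB` — the composite from the ℓ² letter of record (`B₁ := √#{b | b.src ∈ maxDomT M₁ Z 1}·B`), the one-line re-key of the v9 socket;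
  ★★ `hrow_of_support_sup` — the PER-HEIGHT SOCKET: if for every positive-level row `i` and `ξ` there is a preimage `x` of `e_i ξ` vanishing off a finite bond set of size `≤ h` with
  `‖x‖_∞ ≤ B‖ξ‖`, then `hrow` holds at `B₁ := h·B` (ℓ¹ ≤ #supp · sup) — the shape of dag-n12-w6's graded support hull for one-row data (per height `h`) with its sup letter `B`.
  ★ `hK2_of_bound_of_support` — today's inhabitant of the ℓ² velocity letter `hK2` from a per-bond bound × the support letter (`K₂ := a·√#{b | b.src ∈ S}`).
* §2 ★★ `exists_hWD_chartHalf_of_class_uniform_rowl1_family` — constant FAMILIES `C ρ K_τ ρ_τ ρ″ : ι → ℝ` by `choose` and, for every `i`, the ∀-body of §2 of the parent at height `k i`.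

HONEST FRAMING.  Bookkeeping (exact Γ₀ layer, counting, one `choose`); `B₁ = h·B` is per height only if `B` is (dag-n12-w6's LOCATED-B: today's `B` carries volume-dependent sums) —
NOT claimed; nothing of Bałaban's asserted; count-neutral helper; N12 NOT discharged; K1⁹ NOT closed; counts unmoved; one finite 𝕋⁴ programme at fixed ε — R4 closes the conditional
finite-𝕋⁴ rung `BalabanLadder.UV` only; NOT continuum ∕ OS ∕ mass gap ∕ Clay.
[Balaban1989LargeFieldII] p. 357, (1.7) p. 358, (1.12)–(1.13) p. 359; [Balaban1985Variational] (45)–(46) p. 285, (81)–(83) p. 290, (170)–(171) p. 305; [Balaban1988Convergent] (2.2) p. 255, (2.10)–(2.13) pp. 256–257.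
-/

noncomputable section
open scoped BigOperators Matrix.Norms.L2Operator Topology
open Filter Finset

namespace Summit.QuantumFields.YangMills.BalabanUVNodes.N12DirectChartPackageOfClassRowL1Family

open Literature.MathematicalPhysics.QuantumFieldTheory.Balaban1983to89
open Literature.MathematicalPhysics.QuantumLattice (quatMatrix)
open T4Continuum (T4Family)
open T4HaarSU2ExpChart (imQuat)
open T4AdjointCovarianceUnitary (lieSU)
open T4CubeChartGnomonic (SU2)
open B15DeterminingSets GaugeField
open B14.Eq213DetSet (Bj Bj_of_gt maxDomT)
open B14.Eq216Concrete (feeds)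
open B15Prop1SliceCoordinates (GaugeSlice ιA)
open B15Prop1ChartCalculusSU2 (E3)
open B15Prop1ChartSU2 (su2Chart)
open B16Sect1Backgrounds (expMul)
open T4AxialGaugeSmallField (castSite)
open B6TreeGaugePoincare (curl)
open B16Eq18Proof (box)
open LatticeFieldCalculus (runSite)
open BlockAveragingEMLLinearised (linAvg)
open Literature.MathematicalPhysics.QuantumFieldTheory.BalabanImbrieJaffe1984to88.BIJ85Eq453GaugeField (qsstarGIter0)
open Node00
open B16Ineq19FlatSliceChart (exists_lieSU2Coord)
open Summit.QuantumFields.YangMills.BalabanUVNodes.N12NearFlatChartLetter (sum_opNorm_sq_le_l2Seminorm_sq l2Seminorm_le_of_bound_of_support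
  l2Seminorm_le_sqrt_card_mul_norm sum_opNorm_le_sqrt_card_mul_l2Seminorm l2Seminorm_apply)
open Summit.QuantumFields.YangMills.BalabanUVNodes.N12RightInverseLevelZeroLocality (mem_bondsOf_Bj_zero)
open B16Ineq17NearFlatWilsonLetters (fderiv_wilsonAction4_expChart_apply_eq_deriv)
open Summit.QuantumFields.YangMills.BalabanUVNodes.N12NearFlatFederbushFibreRecord (hcons_of_plaqsInside_maxDomT)
open Summit.QuantumFields.YangMills.BalabanUVNodes.N12NearFlatFederbushFibreWindowKnit (runSite_runSite_blockSite_mem_tower)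
open Summit.QuantumFields.YangMills.BalabanUVNodes.N12NearFlatFederbushVelocityWindow (exists_hmX_federbush_window_of_isMinimizer_family)
open Summit.QuantumFields.YangMills.BalabanUVNodes.N12DirectChartLetterCore (exists_twistSize_of_nearFlat_feeds abs_fderiv_wilsonAction4_expChart_apply_le_of_plaqSmall norm_le_sqrt_sum_sq)
open Summit.QuantumFields.YangMills.BalabanUVNodes.N12DirectChartLetterHSupportVacuity (hHsupp_levelZeroFree_of_rightInverse fderiv_fderiv_msChart_levelZeroFree_direct)
open Summit.QuantumFields.YangMills.BalabanUVNodes.N12NearFlatFederbushVelocityWindow (hmX_federbush_window_of_delta2Component)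
open Summit.QuantumFields.YangMills.BalabanUVNodes.N12NearFlatDelta2LetterComponent (exists_delta2_letter_component)
open Summit.QuantumFields.YangMills.BalabanUVNodes.N12DirectChartLetterHSupportVacuity (rightInverse_apply_levelZero)
open Summit.QuantumFields.YangMills.BalabanUVNodes.N12TowerProxiesOfClass (chartLetters_msChart_Bj_of_isMinimizer_of_class exists_lam_msChart_Bj_of_isMinimizer_regMSCoPOfRecord_of_class)
open B14.Eq213MaximalDomains (side)
open B16Ineq19NearFlatSliceNorms (opNorm_coe_le_norm_lieSU)
open Summit.QuantumFields.YangMills.BalabanUVNodes.N12DirectChartPackageOfClassL1Family (sum_opNorm_le_natCard_mul_norm_of_support pi_norm_le_sum_norm hHB1_of_hHB)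
open Summit.QuantumFields.YangMills.BalabanUVNodes.N12DirectChartPackageOfClassRowL1 (exists_hWD_chartHalf_of_class_uniform_rowl1)
open Summit.QuantumFields.YangMills.BalabanUVNodes.N12RightInverseLevelZeroLocality (mem_bondsOf_Bj_zero)

variable {F : T4Family}

/-! ## §1  Inhabitants of the per-row ℓ¹ preimage letter -/

section Inhabitant

/-- ★★ **`hrow` FROM ρ6's ℓ¹ → ℓ¹ LETTER.**  For `U` in the fibre of `W` on a determining set `𝐁 = 𝐁_k(Z)` whose level-0 member is read by `mem_bondsOf_Bj_zero` (so every bond sourced off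
`maxDomT M₁ Z 1` is a level-0 row) with `Ψ` differentiable at `0`, a right inverse `H` carrying `hHB1 : ∀ v, (H v = 0 off Ω₁(Z)) → Σ_b ‖↑(H v)_b‖_op ≤ B₁·Σ_c ‖v_c‖` yields the per-row
letter at the same `B₁`: `x := H (e_i ξ)` vanishes off `Ω₁(Z)` for a positive-level `i` (exact Γ₀ layer: `(DΨ(0) x)(idx b) = x_b = (e_i ξ)(idx b) = 0`), and `Σ_c ‖(e_i ξ)_c‖ = ‖ξ‖`.
[cite: Balaban1988Convergent, (2.2) p.255, (2.11)–(2.12) p.256; Balaban1985Variational, (45)–(46) p.285, (82)–(83) p.290] -/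
theorem hrow_of_hHB1 (ν : Node00.Stage7Numerics) (Kt : ℕ) {k : ℕ} (hk0 : 0 < k) (Z : Set (Site (F.P Kt) 0)) {W : MSField (F.P Kt) SU2} {U : GaugeField (F.P Kt) 0 SU2}
    (hU : AgreeOn (Bj ν.M₁ Z k) (avgFamily (avOfRecord F 2 Kt) U) W) (hΨ : DifferentiableAt ℝ (msChart F 2 Kt k (Bj ν.M₁ Z k) W U) 0)
    (H : (Fin (constrCard (Bj ν.M₁ Z k) k) → lieSU (Fin 2)) → PBond (F.P Kt) 0 → lieSU (Fin 2))
    (hHinv : ∀ v, fderiv ℝ (msChart F 2 Kt k (Bj ν.M₁ Z k) W U) 0 (H v) = v) {B₁ : ℝ}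
    (hHB1 : ∀ v, (∀ b : PBond (F.P Kt) 0, b.src ∉ maxDomT ν.M₁ Z 1 → H v b = 0) → ∑ b, ‖(H v b : Matrix (Fin 2) (Fin 2) ℂ)‖ ≤ B₁ * ∑ c, ‖v c‖) :
    ∀ i : Fin (constrCard (Bj ν.M₁ Z k) k), 1 ≤ ((((constrEnum (Bj ν.M₁ Z k) k).symm i).1 : ℕ)) → ∀ ξ : lieSU (Fin 2),
      ∃ x : PBond (F.P Kt) 0 → lieSU (Fin 2), fderiv ℝ (msChart F 2 Kt k (Bj ν.M₁ Z k) W U) 0 x = Pi.single i ξ ∧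
        ∑ b, ‖(x b : Matrix (Fin 2) (Fin 2) ℂ)‖ ≤ B₁ * ‖ξ‖ := by
  intro i hi ξ
  refine ⟨H (Pi.single i ξ), hHinv _, ?_⟩
  have hsupp : ∀ b : PBond (F.P Kt) 0, b.src ∉ maxDomT ν.M₁ Z 1 → H (Pi.single i ξ) b = 0 := by
    intro b hb
    have hbm : b ∈ bondsOf ((Bj ν.M₁ Z k : DetSet (F.P Kt)) 0) := (mem_bondsOf_Bj_zero hk0 Z b).2 (Or.inl hb)
    have h1 := fderiv_msChart_apply_levelZero hU hΨ b hbm (H (Pi.single i ξ))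
    rw [hHinv] at h1
    have hne : constrEnum (Bj ν.M₁ Z k : DetSet (F.P Kt)) k ⟨⟨0, Nat.succ_pos k⟩, b, hbm⟩ ≠ i := by
      intro h
      have h' := congrArg (fun j => ((((constrEnum (Bj ν.M₁ Z k : DetSet (F.P Kt)) k).symm j).1 : ℕ))) h
      simp only [Equiv.symm_apply_apply] at h'
      omega
    rw [← h1, Pi.single_eq_of_ne hne]
  have hsum : ∑ c, ‖(Pi.single i ξ : Fin (constrCard (Bj ν.M₁ Z k) k) → lieSU (Fin 2)) c‖ = ‖ξ‖ := by
    rw [Finset.sum_eq_single i (fun c _ hc => by rw [Pi.single_eq_of_ne hc, norm_zero]) (fun h => (h (Finset.mem_univ i)).elim), Pi.single_eq_same]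
  calc ∑ b, ‖(H (Pi.single i ξ) b : Matrix (Fin 2) (Fin 2) ℂ)‖ ≤ B₁ * ∑ c, ‖(Pi.single i ξ : Fin (constrCard (Bj ν.M₁ Z k) k) → lieSU (Fin 2)) c‖ := hHB1 _ hsupp
    _ = B₁ * ‖ξ‖ := by rw [hsum]

/-- ★★ **THE PER-HEIGHT SOCKET `hrow_of_support_sup`.**  If every positive-level one-row datum `e_i ξ` has a preimage `x` under `DΨ(0)` vanishing off a finite bond set of at most `h` bonds
and of sup norm `≤ B‖ξ‖`, then the per-row ℓ¹ preimage letter holds at `B₁ := h·B` (ℓ¹ over the support ≤ #supp · sup, operator norm ≤ norm on `𝔰𝔲(2)`).  This is the shape of a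
choice-built block-triangular solver with a graded support hull for one-row data (dag-n12-w6's lineage: `h` per height) and a sup-norm letter `B`.
[cite: Balaban1985Variational, (45)–(46) p.285 (bookkeeping); Balaban1988Convergent, (2.11) p.256] -/
theorem hrow_of_support_sup {P : Params} {n : ℕ} (D : (PBond P 0 → lieSU (Fin 2)) → (Fin n → lieSU (Fin 2))) (pos : Fin n → Prop) {h : ℕ} {B : ℝ}
    (hx : ∀ i, pos i → ∀ ξ : lieSU (Fin 2), ∃ (x : PBond P 0 → lieSU (Fin 2)) (s : Finset (PBond P 0)),
      D x = Pi.single i ξ ∧ (∀ b, b ∉ s → x b = 0) ∧ s.card ≤ h ∧ ‖x‖ ≤ B * ‖ξ‖) :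
    ∀ i, pos i → ∀ ξ : lieSU (Fin 2), ∃ x : PBond P 0 → lieSU (Fin 2), D x = Pi.single i ξ ∧ ∑ b, ‖(x b : Matrix (Fin 2) (Fin 2) ℂ)‖ ≤ ((h : ℝ) * B) * ‖ξ‖ := by
  classical
  intro i hi ξ
  obtain ⟨x, s, hD, hs, hcard, hxB⟩ := hx i hi ξ
  refine ⟨x, hD, ?_⟩
  have hsplit : ∑ b, ‖(x b : Matrix (Fin 2) (Fin 2) ℂ)‖ = ∑ b ∈ s, ‖(x b : Matrix (Fin 2) (Fin 2) ℂ)‖ := by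
    rw [← Finset.sum_subset (Finset.subset_univ s)]
    intro b _ hb
    rw [hs b hb]; simp
  rw [hsplit]
  calc ∑ b ∈ s, ‖(x b : Matrix (Fin 2) (Fin 2) ℂ)‖ ≤ ∑ _b ∈ s, ‖x‖ := Finset.sum_le_sum fun b _ => (opNorm_coe_le_norm_lieSU (x b)).trans (norm_le_pi_norm x b)
    _ = (s.card : ℝ) * ‖x‖ := by rw [Finset.sum_const, nsmul_eq_mul]
    _ ≤ (h : ℝ) * (B * ‖ξ‖) := mul_le_mul (by exact_mod_cast hcard) hxB (norm_nonneg _) (Nat.cast_nonneg _)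
    _ = ((h : ℝ) * B) * ‖ξ‖ := by ring

/-- ★★ **`hrow` FROM THE ℓ² LETTER OF RECORD** (dag-n12-w6's p664681 ∕ p678596 `√(Σ_b ‖(H v)_b‖²) ≤ B‖v‖`, `0 ≤ B`): the per-row letter at `B₁ := √#{b | b.src ∈ maxDomT M₁ Z 1}·B`
(`hrow_of_hHB1 ∘ N12DirectChartPackageOfClassL1Family.hHB1_of_hHB`) — the one-line re-key a consumer of the v9 socket uses today.
[cite: Balaban1985Variational, (45)–(46) p.285; Balaban1988Convergent, (2.2) p.255, (2.11)–(2.12) p.256 (bookkeeping)] -/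
theorem hrow_of_hHB (ν : Node00.Stage7Numerics) (Kt : ℕ) {k : ℕ} (hk0 : 0 < k) (Z : Set (Site (F.P Kt) 0)) {W : MSField (F.P Kt) SU2} {U : GaugeField (F.P Kt) 0 SU2}
    (hU : AgreeOn (Bj ν.M₁ Z k) (avgFamily (avOfRecord F 2 Kt) U) W) (hΨ : DifferentiableAt ℝ (msChart F 2 Kt k (Bj ν.M₁ Z k) W U) 0)
    (H : (Fin (constrCard (Bj ν.M₁ Z k) k) → lieSU (Fin 2)) → PBond (F.P Kt) 0 → lieSU (Fin 2))
    (hHinv : ∀ v, fderiv ℝ (msChart F 2 Kt k (Bj ν.M₁ Z k) W U) 0 (H v) = v) {B : ℝ} (hB0 : 0 ≤ B)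
    (hHB : ∀ v, Real.sqrt (∑ b, ‖H v b‖ ^ 2) ≤ B * ‖v‖) :
    ∀ i : Fin (constrCard (Bj ν.M₁ Z k) k), 1 ≤ ((((constrEnum (Bj ν.M₁ Z k) k).symm i).1 : ℕ)) → ∀ ξ : lieSU (Fin 2),
      ∃ x : PBond (F.P Kt) 0 → lieSU (Fin 2), fderiv ℝ (msChart F 2 Kt k (Bj ν.M₁ Z k) W U) 0 x = Pi.single i ξ ∧
        ∑ b, ‖(x b : Matrix (Fin 2) (Fin 2) ℂ)‖ ≤ (Real.sqrt (Nat.card {b : PBond (F.P Kt) 0 // b.src ∈ maxDomT ν.M₁ Z 1}) * B) * ‖ξ‖ :=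
  hrow_of_hHB1 ν Kt hk0 Z hU hΨ H hHinv (hHB1_of_hHB ν.M₁ Z H hB0 hHB)

/-- ★ **TODAY's INHABITANT OF THE ℓ² VELOCITY LETTER `hK2`** — from (J0′)'s per-bond Cauchy bound `‖(X_f′X)_b‖ ≤ a·‖X‖` and the support letter (`X_f′X = 0` off the bonds sourced in `S`):
`√(Σ_b ‖(X_f′X)_b‖²) ≤ (a·√#{b | b.src ∈ S})·‖X‖` (`N12NearFlatChartLetter.l2Seminorm_le_of_bound_of_support` read through `l2Seminorm_apply`).  The count is the LARGE-FIELD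
REGION's; print's inhabitant is the decay of the chart velocity ([15] (190)), not claimed. [cite: Balaban1989LargeFieldII, (1.13) p.359; Balaban1985Variational, (190) p.308 (bookkeeping)] -/
theorem hK2_of_bound_of_support {P : Params} {V : Type*} [SeminormedAddCommGroup V] (S : Set (Site P 0)) (D : V → PBond P 0 → lieSU (Fin 2)) {a : ℝ} (ha : 0 ≤ a)
    (hb : ∀ X b, ‖D X b‖ ≤ a * ‖X‖) (hs : ∀ X (b : PBond P 0), b.src ∉ S → D X b = 0) :
    ∀ X, Real.sqrt (∑ b, ‖D X b‖ ^ 2) ≤ (a * Real.sqrt (Nat.card {b : PBond P 0 // b.src ∈ S})) * ‖X‖ := by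
  intro X
  have h := l2Seminorm_le_of_bound_of_support (N := 2) S (D X) (a := a * ‖X‖) (by positivity) (fun b => hb X b) (fun b hb => hs X b hb)
  rw [l2Seminorm_apply] at h
  calc Real.sqrt (∑ b, ‖D X b‖ ^ 2) ≤ Real.sqrt (Nat.card {b : PBond P 0 // b.src ∈ S}) * (a * ‖X‖) := h
    _ = (a * Real.sqrt (Nat.card {b : PBond P 0 // b.src ∈ S})) * ‖X‖ := by ring

end Inhabitant

/-! ## §2  The family form of the ρ6b chart half -/

/-- ★★ **THE FAMILY FORM — the consumer's one-liner** for the ρ6b edition: constant FAMILIES `C ρ K_τ ρ_τ ρ″ : ι → ℝ` (by `choose`, one 5-tuple per height) with the signs and,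
for every `i`, the ∀-body of `N12DirectChartPackageOfClassRowL1.exists_hWD_chartHalf_of_class_uniform_rowl1` at height `k i` — the chart-half letter in which the right inverse only
witnesses surjectivity, its size enters through the per-row ℓ¹ preimage letter, the curvature through the ℓ¹-curvature letter and the chart velocity through the ℓ² velocity
letter; discharged BEFORE `ν` is fixed.
[cite: Balaban1989LargeFieldII, p.357, (1.7) p.358, (1.12)–(1.13) p.359; Balaban1985Variational, (45) p.285, (81)–(83) p.290; Balaban1988Convergent, (2.2) p.255, (2.10)–(2.13) pp.256–257] -/
theorem exists_hWD_chartHalf_of_class_uniform_rowl1_family (Kt : ℕ) (h0 : 0 < (F.P Kt).d) {ι : Type*} (k : ι → ℕ) (hk0 : ∀ i, 0 < k i)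
    (hk : ∀ i, k i ≤ (F.P Kt).m + (F.P Kt).K) :
    ∃ C ρ Kτ ρτ ρ'' : ι → ℝ, (∀ i, 0 ≤ C i) ∧ (∀ i, 0 < ρ i) ∧ (∀ i, 0 ≤ Kτ i) ∧ (∀ i, 0 < ρτ i) ∧ (∀ i, 0 < ρ'' i) ∧ ∀ i,
        ∀ (ν : Node00.Stage7Numerics) (Z Λ : Set (Site (F.P Kt) 0)) (T : Finset (PBond (F.P Kt) (k i))) (lo hi : Fin (F.P Kt).d → ℤ),
        (∀ κ, ((((hi κ - lo κ + 1).toNat + 3 : ℕ) : ℤ)) ≤ (F.P Kt).sitesPerDir (k i)) →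
        (∀ (ν' : Fin (F.P Kt).d), ∀ z ∈ box (fun κ => (hi κ - lo κ + 1).toNat + 3) (fun κ => lo κ - 2),
          (castSite z : Site (F.P Kt) (k i)) ∈ pts (k i) (maxDomT ν.M₁ Z (k i)) ∧ (castSite z : Site (F.P Kt) (k i)).shift ⟨0, h0⟩ ∈ pts (k i) (maxDomT ν.M₁ Z (k i)) ∧
            (castSite z : Site (F.P Kt) (k i)).shift ν' ∈ pts (k i) (maxDomT ν.M₁ Z (k i))) →
        (k i) + 1 ≤ (F.P Kt).m + (F.P Kt).K → 4 * (F.P Kt).L ≤ ν.M₁ → side (F.P Kt).L ν.M₁ (k i) ∣ (F.P Kt).sitesPerDir 0 → 0 ≤ ν.εreg →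
        6 * ((((F.P Kt).d - 1 : ℕ)) : ℝ) * (F.P Kt).L * ν.εreg ≤ (ρ'' i) →
        ∀ (ext : GaugeField (F.P Kt) (k i) SU2 → GaugeField (F.P Kt) (k i) SU2) (Vk : GaugeField (F.P Kt) (k i) SU2),
        ∀ (U₀ : GaugeField (F.P Kt) 0 SU2) (Xf : GaugeSlice (pts (k i) Λ) T E3 → PBond (F.P Kt) 0 → lieSU (Fin 2)),
        IsMinimizer (Node00.avOfRecord F 2 Kt) (Node00.regMSCoPOfRecord F 2 ν Kt (k i) (maxDomT ν.M₁ Z)) (Bj ν.M₁ Z (k i))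
          (avgFamily (Node00.avOfRecord F 2 Kt) (qsstarGIter0 (k i) (ext Vk))) U₀ →
        ∀ ⦃εP : ℝ⦄, 0 ≤ εP →
        (∀ p : Plaq (F.P Kt) 0, ((⟨p.src, p.μ⟩ : PBond (F.P Kt) 0) ∈ {b : PBond (F.P Kt) 0 | b.src ∈ maxDomT ν.M₁ Z 1} ∨
            (⟨p.src.shift p.μ, p.ν⟩ : PBond (F.P Kt) 0) ∈ {b : PBond (F.P Kt) 0 | b.src ∈ maxDomT ν.M₁ Z 1} ∨
            (⟨p.src.shift p.ν, p.μ⟩ : PBond (F.P Kt) 0) ∈ {b : PBond (F.P Kt) 0 | b.src ∈ maxDomT ν.M₁ Z 1} ∨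
            (⟨p.src, p.ν⟩ : PBond (F.P Kt) 0) ∈ {b : PBond (F.P Kt) 0 | b.src ∈ maxDomT ν.M₁ Z 1}) →
          ‖((GaugeField.plaqHol U₀ p : SU2) : Matrix (Fin 2) (Fin 2) ℂ) - 1‖ ≤ εP) →
        ∀ (H : (Fin (constrCard (Bj ν.M₁ Z (k i)) (k i)) → lieSU (Fin 2)) → PBond (F.P Kt) 0 → lieSU (Fin 2)),
        (∀ v, fderiv ℝ (msChart F 2 Kt (k i) (Bj ν.M₁ Z (k i)) (avgFamily (avOfRecord F 2 Kt) (qsstarGIter0 (k i) (ext Vk))) U₀) 0 (H v) = v) →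
        ∀ ⦃B₁ : ℝ⦄, 0 ≤ B₁ →
        (∀ i' : Fin (constrCard (Bj ν.M₁ Z (k i)) (k i)), 1 ≤ ((((constrEnum (Bj ν.M₁ Z (k i)) (k i)).symm i').1 : ℕ)) → ∀ ξ : lieSU (Fin 2),
          ∃ x : PBond (F.P Kt) 0 → lieSU (Fin 2), fderiv ℝ (msChart F 2 Kt (k i) (Bj ν.M₁ Z (k i)) (avgFamily (avOfRecord F 2 Kt) (qsstarGIter0 (k i) (ext Vk))) U₀) 0 x = Pi.single i' ξ ∧
            ∑ b, ‖(x b : Matrix (Fin 2) (Fin 2) ℂ)‖ ≤ B₁ * ‖ξ‖) →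
        ∀ ⦃M₂ : ℝ⦄, (∀ w, ∑ c, ‖fderiv ℝ (fderiv ℝ (msChart F 2 Kt (k i) (Bj ν.M₁ Z (k i)) (avgFamily (avOfRecord F 2 Kt) (qsstarGIter0 (k i) (ext Vk))) U₀)) 0 w w c‖ ≤ M₂ * ∑ b, ‖w b‖ ^ 2) →
        Xf 0 = 0 → ContDiffAt ℝ 2 Xf 0 →
        (∀ᶠ Y in 𝓝 (0 : GaugeSlice (pts (k i) Λ) T E3),
          IsMinimizer (Node00.avOfRecord F 2 Kt) (Node00.regMSCoPOfRecord F 2 ν Kt (k i) (maxDomT ν.M₁ Z)) (Bj ν.M₁ Z (k i))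
            (avgFamily (Node00.avOfRecord F 2 Kt) (qsstarGIter0 (k i) (expMul su2Chart (ιA (pts (k i) Λ) T Y) (ext Vk)))) (expChart U₀ (Xf Y))) →
        ∀ ⦃K₂ : ℝ⦄, (∀ X : GaugeSlice (pts (k i) Λ) T E3, Real.sqrt (∑ b, ‖fderiv ℝ Xf 0 X b‖ ^ 2) ≤ K₂ * ‖X‖) →
        ∀ (W : Finset (Plaq (F.P Kt) 0)),
        (∀ q : Plaq (F.P Kt) 0, q.src ∈ ((box (fun κ => (F.P Kt).L ^ (k i) * ((hi κ - lo κ + 1).toNat + 3 + 1) - 1) (fun κ => ((F.P Kt).L : ℤ) ^ (k i) * (lo κ - 2))).image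
            (fun z => (castSite z : Site (F.P Kt) 0))) → q ∈ W) →
        ∀ ⦃δW : ℝ⦄, 0 < δW → δW < (ρ i) → δW < (ρτ i) →
        (∀ (ν' : Fin (F.P Kt).d), ∀ z ∈ box (fun κ => (hi κ - lo κ + 1).toNat + 3) (fun κ => lo κ - 2), ∀ b₀ : PBond (F.P Kt) 0,
          (b₀ ∈ feeds (k i) (⟨(castSite z : Site (F.P Kt) (k i)), ⟨0, h0⟩⟩ : PBond (F.P Kt) (k i)) ∨ b₀ ∈ feeds (k i) (⟨((castSite z : Site (F.P Kt) (k i))).shift ⟨0, h0⟩, ν'⟩ : PBond (F.P Kt) (k i))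
          ∨ b₀ ∈ feeds (k i) (⟨((castSite z : Site (F.P Kt) (k i))).shift ν', ⟨0, h0⟩⟩ : PBond (F.P Kt) (k i)) ∨ b₀ ∈ feeds (k i) (⟨(castSite z : Site (F.P Kt) (k i)), ν'⟩ : PBond (F.P Kt) (k i))) →
          ‖((U₀ b₀ : SU2) : Matrix (Fin 2) (Fin 2) ℂ) - 1‖ ≤ δW) →
        ∃ (Ψ₂ : (PBond (F.P Kt) 0 → lieSU (Fin 2)) →L[ℝ] (PBond (F.P Kt) 0 → lieSU (Fin 2)) →L[ℝ] (Fin (constrCard (Bj ν.M₁ Z (k i)) (k i)) → lieSU (Fin 2)))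
          (lam : (Fin (constrCard (Bj ν.M₁ Z (k i)) (k i)) → lieSU (Fin 2)) →L[ℝ] ℝ)
          (p : Seminorm ℝ (PBond (F.P Kt) 0 → lieSU (Fin 2))),
          HasFDerivAt (fun Y => fderiv ℝ (msChart F 2 Kt (k i) (Bj ν.M₁ Z (k i)) (avgFamily (avOfRecord F 2 Kt) (qsstarGIter0 (k i) (ext Vk))) U₀) Y) Ψ₂ 0 ∧
          (∀ᶠ Y in 𝓝 (0 : PBond (F.P Kt) 0 → lieSU (Fin 2)), DifferentiableAt ℝ (msChart F 2 Kt (k i) (Bj ν.M₁ Z (k i)) (avgFamily (avOfRecord F 2 Kt) (qsstarGIter0 (k i) (ext Vk))) U₀) Y) ∧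
          fderiv ℝ (fun Y : PBond (F.P Kt) 0 → lieSU (Fin 2) => wilsonAction4 (expChart U₀ Y)) 0 = lam.comp (fderiv ℝ (msChart F 2 Kt (k i) (Bj ν.M₁ Z (k i)) (avgFamily (avOfRecord F 2 Kt) (qsstarGIter0 (k i) (ext Vk))) U₀) 0) ∧
          (∀ Y : PBond (F.P Kt) 0 → lieSU (Fin 2), ∑ b, ‖(Y b : Matrix (Fin 2) (Fin 2) ℂ)‖ ^ 2 ≤ p Y ^ 2) ∧
          ∀ X : GaugeSlice (pts (k i) Λ) T E3,
            lam (Ψ₂ (fderiv ℝ Xf 0 X) (fderiv ℝ Xf 0 X))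
                ≤ (2 * (((F.P Kt).d : ℝ) - 1) * εP * B₁ * M₂) * p (fderiv ℝ Xf 0 X) ^ 2 ∧
            p (fderiv ℝ Xf 0 X) ≤ K₂ * ‖X‖ ∧
            (((F.P Kt).L : ℝ) ^ (F.P Kt).d) ^ (k i) / ((((F.P Kt).L : ℝ)) ^ 2 * ((F.P Kt).L : ℝ) ^ 2) ^ (k i) / 2 * (∑ z ∈ box (fun κ => (hi κ - lo κ + 1).toNat + 3) (fun κ => lo κ - 2), ∑ μ : Fin (F.P Kt).d, ∑ a : Fin 3, curl (fun b => ιA (pts (k i) Λ) T X (⟨castSite b.1, b.2⟩ : PBond (F.P Kt) (k i)) a) z ⟨0, h0⟩ μ ^ 2)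
                - (((F.P Kt).L : ℝ) ^ (F.P Kt).d) ^ (k i) / ((((F.P Kt).L : ℝ)) ^ 2 * ((F.P Kt).L : ℝ) ^ 2) ^ (k i) * (8 * (((F.P Kt).d : ℝ) + 1) * (2 * ((Kτ i) + 1) * δW) + 8 * ((F.P Kt).d : ℝ) * (((box (fun κ => (hi κ - lo κ + 1).toNat + 3) (fun κ => lo κ - 2)).image (fun z => (castSite z : Site (F.P Kt) (k i)))).card : ℝ) * ((C i) * δW * K₂) ^ 2) * ‖X‖ ^ 2
              ≤ ((Fintype.card (Fin 2) : ℝ)⁻¹ • ∑ p ∈ W, (innerSL ℝ (E := lieSU (Fin 2))).bilinearComp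
                (ContinuousLinearMap.proj (R := ℝ) (φ := fun _ : PBond (F.P Kt) 0 => lieSU (Fin 2)) (⟨p.src, p.μ⟩ : PBond (F.P Kt) 0) + ContinuousLinearMap.proj (R := ℝ) (φ := fun _ : PBond (F.P Kt) 0 => lieSU (Fin 2)) (⟨p.src.shift p.μ, p.ν⟩ : PBond (F.P Kt) 0)
                  - ContinuousLinearMap.proj (R := ℝ) (φ := fun _ : PBond (F.P Kt) 0 => lieSU (Fin 2)) (⟨p.src.shift p.ν, p.μ⟩ : PBond (F.P Kt) 0) - ContinuousLinearMap.proj (R := ℝ) (φ := fun _ : PBond (F.P Kt) 0 => lieSU (Fin 2)) (⟨p.src, p.ν⟩ : PBond (F.P Kt) 0) : (PBond (F.P Kt) 0 → lieSU (Fin 2)) →L[ℝ] lieSU (Fin 2))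
                (ContinuousLinearMap.proj (R := ℝ) (φ := fun _ : PBond (F.P Kt) 0 => lieSU (Fin 2)) (⟨p.src, p.μ⟩ : PBond (F.P Kt) 0) + ContinuousLinearMap.proj (R := ℝ) (φ := fun _ : PBond (F.P Kt) 0 => lieSU (Fin 2)) (⟨p.src.shift p.μ, p.ν⟩ : PBond (F.P Kt) 0)
                  - ContinuousLinearMap.proj (R := ℝ) (φ := fun _ : PBond (F.P Kt) 0 => lieSU (Fin 2)) (⟨p.src.shift p.ν, p.μ⟩ : PBond (F.P Kt) 0) - ContinuousLinearMap.proj (R := ℝ) (φ := fun _ : PBond (F.P Kt) 0 => lieSU (Fin 2)) (⟨p.src, p.ν⟩ : PBond (F.P Kt) 0) : (PBond (F.P Kt) 0 → lieSU (Fin 2)) →L[ℝ] lieSU (Fin 2))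
                : (PBond (F.P Kt) 0 → lieSU (Fin 2)) →L[ℝ] (PBond (F.P Kt) 0 → lieSU (Fin 2)) →L[ℝ] ℝ) (fderiv ℝ Xf 0 X) (fderiv ℝ Xf 0 X) := by
  choose C ρ Kτ ρτ ρ'' hC hρ hKτ hρτ hρ'' hh using fun i => exists_hWD_chartHalf_of_class_uniform_rowl1 (F := F) Kt h0 (hk0 i) (hk i)
  exact ⟨C, ρ, Kτ, ρτ, ρ'', hC, hρ, hKτ, hρτ, hρ'', hh⟩


end Summit.QuantumFields.YangMills.BalabanUVNodes.N12DirectChartPackageOfClassRowL1Family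

end
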